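import Literature.NumberTheory.EllipticCurves.Gamma0EisensteinHeckeIdentity
import Literature.NumberTheory.EllipticCurves.ModularCurve
import HarnessLib

/-!
# The Eisenstein series of the cusp `∞` of `Γ₀(N)`, II: the residue
# `lim_{s→1⁺} (s − 1) G_N(z, s) = 6/(π [SL₂(ℤ) : Γ₀(N)])`

Topic `Literature/NumberTheory/EllipticCurves`; theorems only (no definition, no named fact). Sequel of
`Gamma0EisensteinHeckeIdentity.lean` and fifth brick of the printed proof behind the named fact
`murty_petersson_newform_lower_bound` (Murty 1999, §2): with
`G_t(z, s) = Σ_{(c,d)=1, t ∣ c} (y/|cz+d|²)ˢ = 2E_∞^{Γ₀(t)}(z, s)` and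
`J_s(u) = Σ_{de=u} μ(d) e^{2s}`,

1. `tendsto_sub_one_mul_moebius_mul_tsum_coprime`: **`(s − 1) J_s(t) G_t(z, s) → 6φ(t)/π`** as
   `s → 1⁺`, by strong induction over `t`: the Hecke-type identity
   `Σ_{u ∣ t} J_s(u) G_u(z, s) = tˢ G₁(tz, s)` (part I), the level-one residue
   `(s − 1) G₁(tz, s) → 6/π` (part I, from the tree's `completedEisenstein_eq`), the induction
   hypothesis at the proper divisors, and Gauss' `Σ_{u ∣ t} φ(u) = t` (Mathlib `Nat.sum_totient`).
2. `moebius_mul_sq_eq_gamma0Index_mul_totient`: **`J₂(n) = Σ_{de=n} μ(d)e² = [SL₂(ℤ):Γ₀(n)]·φ(n)`**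
   with the tree's `gamma0Index n = ∏_{p^e ∥ n} p^{e-1}(p+1)` (`ModularCurve.lean`; equal to the
   index by `index_gamma0_eq_gamma0Index_holds`): multiplicativity of `μ ∗ id²` (Mathlib
   `ArithmeticFunction.IsMultiplicative`) and `J₂(pᵏ) = p^{2k} − p^{2k−2}`
   (`moebius_mul_sq_prime_pow`); `gamma0Index_pos`.
3. `tendsto_sub_one_mul_tsum_coprime_dvd`: **the residue**
   `(s − 1) G_t(z, s) → 6/(π · gamma0Index t)` as `s → 1⁺` (real `s`), i.e.
   `res_{s=1} E_∞^{Γ₀(N)}(z, s) = 3/(π [SL₂(ℤ):Γ₀(N)]) = 1/vol(Γ₀(N)\ℍ)` (Iwaniec (3.26) with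
   Thm. 11.3/(6.33): the residue of every Eisenstein series at `s = 1` is `1/|F|`; here obtained
   by elementary means from level one).

## References

* [Iwaniec2002] H. Iwaniec, *Spectral Methods of Automorphic Forms*, GSM 53, (3.26), (6.33),
  §13.? (`Γ₀(N)`).
* [DiamondShurman2005] F. Diamond, J. Shurman, GTM 228, §4.2 (level `N` from level one),
  Ex. 1.2.3 (`[SL₂(ℤ):Γ₀(N)] = N∏(1+1/p)`).
* [ShimuraIATAF1971] G. Shimura, *Introduction to the arithmetic theory of automorphic functions*,
  Prop. 1.43 (the index).
* [Murty1999CongruencePrimes] M. R. Murty, *Bounds for congruence primes* (1999), §2.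
-/

noncomputable section

open scoped MatrixGroups ModularForm Real Topology ENNReal NNReal
open UpperHalfPlane hiding I
open MeasureTheory Set Filter Complex EisensteinSeries ArithmeticFunction
open scoped ArithmeticFunction.Moebius
open Literature.NumberTheory.Automorphic

namespace Literature.NumberTheory.EllipticCurves.ModularForms

/-! ### The limit `(s − 1) J_s(t) G_t(z, s) → 6φ(t)/π` -/

section LevelN

open ArithmeticFunction

/-- **`(s − 1) J_s(t) G_t(z, s) → 6φ(t)/π` as `s → 1⁺`** (`t ≥ 1`, `z ∈ ℍ`;
`G_t(z,s) = Σ_{(c,d)=1, t∣c}(y/|cz+d|²)ˢ`, `J_s(t) = Σ_{de=t} μ(d)e^{2s}`): strong induction over `t`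
from `Σ_{u ∣ t} J_s(u) G_u(z, s) = tˢ G₁(tz, s)` (`sum_divisors_moebius_mul_tsum_coprime_eq`), the
level-one residue `(s − 1) G₁(tz, s) → 6/π` (`tendsto_sub_one_mul_tsum_coprime`) and
`Σ_{u ∣ t} φ(u) = t`: the limit is `6t/π − (6/π) Σ_{u ∣ t, u < t} φ(u) = 6φ(t)/π`.
[cite: Iwaniec2002, (3.26) & (6.33) (residues of Eisenstein series), PDF pp. 47, 89] -/
theorem tendsto_sub_one_mul_moebius_mul_tsum_coprime (z : ℍ) {t : ℕ} (ht : 0 < t) :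
    Tendsto (fun s : ℝ ↦ (s - 1) *
        ((∑ x ∈ t.divisorsAntidiagonal, (moebius x.1 : ℝ) * (x.2 : ℝ) ^ (2 * s)) *
          ∑' v : {v : Fin 2 → ℤ // IsCoprime (v 0) (v 1) ∧ (t : ℤ) ∣ v 0},
            (z.im / Complex.normSq ((v.1 0 : ℂ) * z + v.1 1)) ^ s))
      (𝓝[>] 1) (𝓝 (6 * (t.totient : ℝ) / π)) := by
  induction t using Nat.strong_induction_on generalizing z with
  | _ t IH =>
  set tz : ℍ := (⟨t, by exact_mod_cast ht⟩ : {x : ℝ // 0 < x}) • z with htz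
  -- the identity, eventually
  have hid : ∀ s : ℝ, 1 < s →
      (s - 1) * ((∑ x ∈ t.divisorsAntidiagonal, (moebius x.1 : ℝ) * (x.2 : ℝ) ^ (2 * s)) *
          ∑' v : {v : Fin 2 → ℤ // IsCoprime (v 0) (v 1) ∧ (t : ℤ) ∣ v 0},
            (z.im / Complex.normSq ((v.1 0 : ℂ) * z + v.1 1)) ^ s) =
      (t : ℝ) ^ s * ((s - 1) * ∑' v : {v : Fin 2 → ℤ // IsCoprime (v 0) (v 1) ∧ ((1 : ℕ) : ℤ) ∣ v 0},
        (tz.im / Complex.normSq ((v.1 0 : ℂ) * tz + v.1 1)) ^ s) -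
      ∑ u ∈ t.divisors.erase t, (s - 1) *
        ((∑ x ∈ u.divisorsAntidiagonal, (moebius x.1 : ℝ) * (x.2 : ℝ) ^ (2 * s)) *
          ∑' v : {v : Fin 2 → ℤ // IsCoprime (v 0) (v 1) ∧ (u : ℤ) ∣ v 0},
            (z.im / Complex.normSq ((v.1 0 : ℂ) * z + v.1 1)) ^ s) := by
    intro s hs
    have h := sum_divisors_moebius_mul_tsum_coprime_eq z hs ht
    rw [← htz] at h
    rw [← Finset.sum_erase_add _ _ (Nat.mem_divisors_self t ht.ne')] at h
    rw [← Finset.mul_sum]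
    have h' := congrArg (fun x ↦ (s - 1) * x) h
    linear_combination h'
  -- limits of the pieces
  have hG1 := tendsto_sub_one_mul_tsum_coprime tz
  have hpow : Tendsto (fun s : ℝ ↦ (t : ℝ) ^ s) (𝓝[>] 1) (𝓝 (t : ℝ)) := by
    have h := (Real.continuousAt_const_rpow (a := (t : ℝ)) (b := 1)
      (by exact_mod_cast ht.ne')).tendsto
    rw [Real.rpow_one] at h
    exact h.mono_left nhdsWithin_le_nhds
  have hIH : ∀ u ∈ t.divisors.erase t, Tendsto (fun s : ℝ ↦ (s - 1) *
      ((∑ x ∈ u.divisorsAntidiagonal, (moebius x.1 : ℝ) * (x.2 : ℝ) ^ (2 * s)) *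
        ∑' v : {v : Fin 2 → ℤ // IsCoprime (v 0) (v 1) ∧ (u : ℤ) ∣ v 0},
          (z.im / Complex.normSq ((v.1 0 : ℂ) * z + v.1 1)) ^ s))
      (𝓝[>] 1) (𝓝 (6 * (u.totient : ℝ) / π)) := by
    intro u hu
    rw [Finset.mem_erase, Nat.mem_divisors] at hu
    have hupos : 0 < u := Nat.pos_of_dvd_of_pos hu.2.1 ht
    have hult : u < t := lt_of_le_of_ne (Nat.le_of_dvd ht hu.2.1) hu.1
    exact IH u hult z hupos
  have hlim := (hpow.mul hG1).sub (tendsto_finsetSum _ hIH)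
  have hval : (t : ℝ) * (6 / π) - ∑ u ∈ t.divisors.erase t, 6 * (u.totient : ℝ) / π =
      6 * (t.totient : ℝ) / π := by
    have hsum : ∑ u ∈ t.divisors, (u.totient : ℝ) = t := by exact_mod_cast Nat.sum_totient t
    rw [← Finset.sum_erase_add _ _ (Nat.mem_divisors_self t ht.ne')] at hsum
    have : ∑ u ∈ t.divisors.erase t, 6 * (u.totient : ℝ) / π =
        (6 / π) * ∑ u ∈ t.divisors.erase t, (u.totient : ℝ) := by
      rw [Finset.mul_sum]
      refine Finset.sum_congr rfl fun u _ ↦ ?_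
      ring
    rw [this]
    have hπ : (π : ℝ) ≠ 0 := Real.pi_ne_zero
    field_simp
    linarith
  rw [hval] at hlim
  refine hlim.congr' ?_
  filter_upwards [self_mem_nhdsWithin] with s hs
  exact (hid s hs).symm

end LevelN


/-! ### `J₂(n) = [SL₂(ℤ):Γ₀(n)] φ(n)` -/

section JordanTotient

/-- `J₂(pᵏ) = Σ_{de = pᵏ} μ(d) e² = p^{2k} − p^{2k−2} = p^{k−1}(p+1) · p^{k−1}(p−1)` for a prime `p`
and `k ≥ 1` (`μ(pⁱ) = 0` for `i ≥ 2`). [folklore] -/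
theorem moebius_mul_sq_prime_pow {p k : ℕ} (hp : p.Prime) (hk : 0 < k) :
    ∑ x ∈ (p ^ k).divisorsAntidiagonal, (μ x.1 : ℤ) * (x.2 : ℤ) ^ 2 =
      ((p ^ (k - 1) * (p + 1) * (p ^ (k - 1) * (p - 1)) : ℕ) : ℤ) := by
  rw [← Nat.map_div_right_divisors, Finset.sum_map, Nat.divisors_prime_pow hp k, Finset.sum_map]
  simp only [Function.Embedding.coeFn_mk]
  have hterm : ∀ i ∈ Finset.range (k + 1), (μ (p ^ i) : ℤ) * ((p ^ k / p ^ i : ℕ) : ℤ) ^ 2 =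
      if i = 0 then (p : ℤ) ^ (2 * k) else if i = 1 then -(p : ℤ) ^ (2 * (k - 1)) else 0 := by
    intro i hi
    rw [Finset.mem_range] at hi
    have hik : i ≤ k := by omega
    rw [Nat.pow_div hik hp.pos]
    rcases Nat.eq_zero_or_pos i with rfl | hipos
    · simp [← pow_mul, mul_comm]
    · rw [moebius_apply_prime_pow hp hipos.ne']
      by_cases hi1 : i = 1
      · subst hi1
        simp only [if_true, Int.reduceNeg, neg_mul, one_mul, one_ne_zero, if_false]
        push_cast
        ring
      · rw [if_neg hi1, if_neg (by omega), if_neg hi1]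
        simp
  rw [Finset.sum_congr rfl hterm]
  rw [Finset.sum_ite, Finset.sum_ite]
  simp only [Finset.sum_const_zero, add_zero, Finset.sum_const]
  have hf0 : (Finset.filter (fun i ↦ i = 0) (Finset.range (k + 1))).card = 1 := by
    rw [Finset.card_eq_one]
    exact ⟨0, by ext i; simp⟩
  have hf1 : (Finset.filter (fun i ↦ i = 1) (Finset.filter (fun i ↦ ¬i = 0) (Finset.range (k + 1)))).card = 1 := by
    rw [Finset.card_eq_one]
    refine ⟨1, ?_⟩
    ext i
    simp only [Finset.mem_filter, Finset.mem_range, Finset.mem_singleton]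
    omega
  rw [hf0, hf1]
  obtain ⟨j, rfl⟩ : ∃ j, k = j + 1 := ⟨k - 1, by omega⟩
  simp only [Nat.add_sub_cancel]
  have hp1 : 1 ≤ p := hp.one_le
  push_cast [Nat.cast_sub hp1]
  ring

/-- **Jordan's totient `J₂(n) = Σ_{de=n} μ(d) e²` equals `[SL₂(ℤ):Γ₀(n)] · φ(n)`** (with the
tree's `gamma0Index n = ∏_{p^e ∥ n} p^{e−1}(p+1)`, `ModularCurve.lean`): `μ ∗ id²` is
multiplicative (Mathlib), so both sides are products over the factorisation, and at `pᵏ` they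
agree by `moebius_mul_sq_prime_pow` and Euler's `φ(pᵏ) = p^{k−1}(p−1)`. (Diamond–Shurman
Ex. 1.2.3; `J₂ = φ · ψ` with Dedekind's `ψ`.) [folklore] -/
theorem moebius_mul_sq_eq_gamma0Index_mul_totient {n : ℕ} (hn : n ≠ 0) :
    ∑ x ∈ n.divisorsAntidiagonal, (μ x.1 : ℤ) * (x.2 : ℤ) ^ 2 =
      ((gamma0Index n * n.totient : ℕ) : ℤ) := by
  set F : ArithmeticFunction ℤ := (μ : ArithmeticFunction ℤ) * ((pow 2 : ArithmeticFunction ℕ) : ArithmeticFunction ℤ)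
    with hF
  have hFapp : ∀ m : ℕ, F m = ∑ x ∈ m.divisorsAntidiagonal, (μ x.1 : ℤ) * (x.2 : ℤ) ^ 2 := by
    intro m
    rw [hF, mul_apply]
    refine Finset.sum_congr rfl fun x hx ↦ ?_
    rw [natCoe_apply, pow_apply]
    simp
  have hmult : F.IsMultiplicative := isMultiplicative_moebius.mul isMultiplicative_pow.natCast
  rw [← hFapp, IsMultiplicative.multiplicative_factorization F hmult hn, gamma0Index,
    Nat.totient_eq_prod_factorization hn, ← Finsupp.prod_mul, Nat.cast_finsuppProd]
  refine Finset.prod_congr rfl fun p hp ↦ ?_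
  have hprime : p.Prime := Nat.prime_of_mem_primeFactors (Nat.support_factorization n ▸ hp)
  have hk : 0 < n.factorization p := Nat.pos_of_ne_zero (Finsupp.mem_support_iff.mp hp)
  show F (p ^ n.factorization p) = _
  rw [hFapp, moebius_mul_sq_prime_pow hprime hk]

end JordanTotient


/-! ### The residue -/

section Residue

/-- `gamma0Index t > 0` (a product of the positive integers `p^{e−1}(p+1)`). [folklore] -/
theorem gamma0Index_pos (t : ℕ) : 0 < gamma0Index t := by
  unfold gamma0Index Finsupp.prod
  refine Finset.prod_pos fun p hp ↦ ?_
  have hprime : p.Prime := Nat.prime_of_mem_primeFactors (Nat.support_factorization t ▸ hp)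
  exact mul_pos (pow_pos hprime.pos _) (Nat.succ_pos _)

/-- `J_s(t) = Σ_{de=t} μ(d) e^{2s} → J₂(t) = gamma0Index t · φ(t)` as `s → 1⁺` (a finite sum of
continuous functions of `s`). [folklore] -/
theorem tendsto_moebius_sum_one {t : ℕ} (ht : 0 < t) :
    Tendsto (fun s : ℝ ↦ ∑ x ∈ t.divisorsAntidiagonal, (μ x.1 : ℝ) * (x.2 : ℝ) ^ (2 * s)) (𝓝[>] 1)
      (𝓝 ((gamma0Index t * t.totient : ℕ) : ℝ)) := by
  have hcont : ContinuousAt (fun s : ℝ ↦ ∑ x ∈ t.divisorsAntidiagonal, (μ x.1 : ℝ) * (x.2 : ℝ) ^ (2 * s)) 1 := by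
    refine tendsto_finsetSum _ fun x hx ↦ ?_
    have hx2 : 0 < x.2 := Nat.pos_of_mem_divisors (Nat.snd_mem_divisors_of_mem_antidiagonal hx)
    refine ContinuousAt.mul continuousAt_const ?_
    exact (Real.continuousAt_const_rpow (by exact_mod_cast hx2.ne')).comp
      (continuousAt_const.mul continuousAt_id)
  have hval : ∑ x ∈ t.divisorsAntidiagonal, (μ x.1 : ℝ) * (x.2 : ℝ) ^ (2 * (1 : ℝ)) =
      ((gamma0Index t * t.totient : ℕ) : ℝ) := by
    have h := moebius_mul_sq_eq_gamma0Index_mul_totient ht.ne'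
    have h' := congrArg (fun x : ℤ ↦ (x : ℝ)) h
    simp only [Int.cast_sum, Int.cast_mul, Int.cast_pow, Int.cast_natCast] at h'
    rw [← h']
    refine Finset.sum_congr rfl fun x _ ↦ ?_
    rw [mul_one, show (2 : ℝ) = ((2 : ℕ) : ℝ) by norm_num, Real.rpow_natCast]
  rw [← hval]
  exact hcont.tendsto.mono_left nhdsWithin_le_nhds

/-- **The residue of the Eisenstein series of the cusp `∞` of `Γ₀(t)` at `s = 1`**: for `t ≥ 1`
and `z ∈ ℍ`, `(s − 1) · Σ_{(c,d)=1, t ∣ c} (y/|cz+d|²)ˢ → 6/(π · gamma0Index t)` as `s → 1⁺`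
(real `s`), i.e. `res_{s=1} E_∞^{Γ₀(t)}(z, s) = 3/(π [SL₂(ℤ):Γ₀(t)]) = 1/vol(Γ₀(t)\ℍ)`, from
`tendsto_sub_one_mul_moebius_mul_tsum_coprime` divided by `J_s(t) → J₂(t) = gamma0Index t · φ(t) ≠ 0`.
(Iwaniec (3.26), (6.33): every Eisenstein series has residue `1/|F|` at `s = 1`.)
[cite: Iwaniec2002, (6.33) (res_{s=1} E_𝔞(z,s) = 1/|F|), PDF p. 89; level one (3.26), PDF p. 47] -/
theorem tendsto_sub_one_mul_tsum_coprime_dvd (z : ℍ) {t : ℕ} (ht : 0 < t) :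
    Tendsto (fun s : ℝ ↦ (s - 1) *
        ∑' v : {v : Fin 2 → ℤ // IsCoprime (v 0) (v 1) ∧ (t : ℤ) ∣ v 0},
          (z.im / Complex.normSq ((v.1 0 : ℂ) * z + v.1 1)) ^ s)
      (𝓝[>] 1) (𝓝 (6 / (π * gamma0Index t))) := by
  have hJ := tendsto_moebius_sum_one ht
  have hQ := tendsto_sub_one_mul_moebius_mul_tsum_coprime z ht
  have hJ0 : ((gamma0Index t * t.totient : ℕ) : ℝ) ≠ 0 := by
    have h1 := gamma0Index_pos t
    have h2 := Nat.totient_pos.mpr ht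
    positivity
  have hdiv := hQ.div hJ hJ0
  have hval : 6 * (t.totient : ℝ) / π / ((gamma0Index t * t.totient : ℕ) : ℝ) = 6 / (π * gamma0Index t) := by
    have hφ : (t.totient : ℝ) ≠ 0 := by exact_mod_cast (Nat.totient_pos.mpr ht).ne'
    have hg : (gamma0Index t : ℝ) ≠ 0 := by exact_mod_cast (gamma0Index_pos t).ne'
    push_cast
    field_simp
  rw [hval] at hdiv
  have hne : ∀ᶠ s : ℝ in 𝓝[>] 1, ∑ x ∈ t.divisorsAntidiagonal, (μ x.1 : ℝ) * (x.2 : ℝ) ^ (2 * s) ≠ 0 :=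
    hJ.eventually_ne hJ0
  refine hdiv.congr' ?_
  filter_upwards [hne] with s hs
  simp only [Pi.div_apply]
  rw [mul_div_assoc, mul_div_cancel_left₀ _ hs]

end Residue

end Literature.NumberTheory.EllipticCurves.ModularForms

end
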